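import Literature.NumberTheory.ComplexMultiplication.CMTypeUniformizationRationalMultiplications
import Literature.AlgebraicGeometry.Motives.AbelianVarietyTangentKillers
import Literature.AlgebraicGeometry.Motives.AbelianVarietyTangentCotangentBridge
import HarnessLib

/-!
# The `𝔮`-multiplication lies in `ι(𝔮) · Hom(A, B)`, so its reduction kills every tangent vector killed by `ι̃(𝔮)`
# (Shimura 1998, §7.4 Prop. 15 / Prop. 17; §13.1 proof of Thm. 1, p. 98; §18.6 p. 129 — μ-free form)

Topic `Literature/NumberTheory/ComplexMultiplication`, namespace
`Literature.NumberTheory.ComplexMultiplication.CMTypeUniformization`.  THEOREMS ONLY (no definition, no named fact,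
no instance; net Literature debt 0).  Cell `hodgecm-mathlib` (D-0151), E2 line («height-one road» for the degree-one
Shimura–Taniyama congruence `shimuraTaniyamaPair_degOne'`), piece R2 of the μ-free road of record (A-p02 allocation
v1.1–v1.5): the TOP of the stub `stub_tangentKill` of the assembly `shimuraTaniyamaPair_degOne'_holds`.

THE PRINT ([Shimura1998]).  §13.1, proof of THEOREM 1 (p. 98) and §18.6 p. 129: the differential of the reduced
`𝔮`-multiplication vanishes, `δλ̃ = 0`, because `δι̃(α) = 0` for `α ∈ 𝔮 = g(𝔭)`; the print routes this through an
auxiliary multiplication `μ : B → A` with `μλ = ι(α)` — whose REDUCTION the typed fact cannot form (it binds only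
`H : HomReduction R S`, direction `A → B`; `HomReduction S R` is the unproved named fact `nonempty_homReduction`).
We replace `μ` by the identity `λ = Σᵢ ι_A(αᵢ) ∘ λ_{γᵢ}` (`αᵢ ∈ 𝔮`, `γᵢ ∈ 𝔮⁻¹`, `Σ αᵢγᵢ = 1`), which uses
multiplications `A → B` only; these are ALL rational over the field of definition `k` of `λ`
(`CMTypeUniformizationRationalMultiplications`, [Shimura1998] §7.4 Prop. 15 / proof of Prop. 17: «every homomorphism
of `(A₁, ι₁)` into `(A₂, ι₂)` corresponds to some `S(γ)` such that `γ ∈ 𝔞⁻¹𝔟`»).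

SETTING.  `(A, ιA)`, `(B, ιB)` abelian varieties with `𝓞_K`-action over a countable field `k ⊆ ℂ`, uniformised as
`ℂ^Φ/D(𝔞)`, `ℂ^Φ/D(𝔟)` either in the base-change shape (`ξ : CMTypeUniformization Φ 𝔞 (A ⊗ ℂ) (ιA ⊗ ℂ)`, the
currency of `CMTypeUniformizationDescendedMultiplications`) or in the `k`-shape of the named fact
(`ξ₀ : CMTypeUniformization Φ 𝔞 A ιA`); `𝔮 ⊆ 𝓞_K` with `𝔮 𝔟 = 𝔞`; `λ : A ⟶ B` the `𝔮`-multiplication,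
`λ(ξ.r u) = η.r u` («the identity map of `ℂⁿ` defines `λ`», p. 166).

* §1 `mem_closure_ι_comp_of_baseChange_map_r_eq` / `…_of_map_r_eq` — **`λ ∈ ⟨ι_A(𝔮) ≫ Hom_k(A, B)⟩`**: `λ`
  belongs to the additive subgroup of `Hom_k(A, B)` generated by the composites `ιA(α) ≫ g`, `α ∈ 𝔮`, `g : A ⟶ B`
  (from `1 ∈ 𝔮 𝔮⁻¹`: a sum `Σ αᵢ γᵢ` gives the member `Σ ιA(αᵢ) ≫ λ_{γᵢ}` with the `k`-rational `λ_{γᵢ}` of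
  `exists_hom_baseChange_map_r_eq_of_qMultiplication`; it induces `S(Σ αᵢγᵢ) = S(1)` as `λ` does, and a
  `k`-homomorphism is determined by the `S(c)` it induces, `hom_eq_of_forall_baseChange_map_r_eq`).
* §2 `forall_comp_redHom_eq_one_of_baseChange_map_r_eq` / `…_of_map_r_eq` — **top of `stub_tangentKill`**: for a
  reduction-of-homomorphisms datum `H : HomReduction R S` at a place `v` of the number field `k` ([Shimura1998]
  §11.1 Prop. 12), if every reduced endomorphism `R.redEnd (ιA α)`, `α ∈ 𝔮`, kills every `Rκ`-point of `Ā` at the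
  origin (augmentation `aug : Rκ → R₀` of `κ(v)`-algebras; the assembly takes `Rκ = κ(Ã)[ε]`, `aug = fst` — this is
  the P1 input «`δι̃(α) = 0`»), then so does `λ̃ = H.redHom λ` (§1 and the two-sided ideal
  `AbelianVarietyTangentKillers`).

HC_CM is proved only modulo the 7 printed citations until rung 0 closes.

## References
* [Shimura1998] G. Shimura, *Abelian Varieties with Complex Multiplication and Modular Functions* (1998), §7.4
  Prop. 15 and proof of Prop. 17 (p. 58); §11.1 Prop. 12; §13.1 proof of Thm. 1 (p. 98); §18.6 proof of
  Thm. 18.6 (pp. 128–129, 166).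
* [Milne2005ShimuraVarieties] J. S. Milne, *Introduction to Shimura Varieties* (2005/2017), Prop. 13.1 p. 117.
-/

set_option autoImplicit false

noncomputable section

open CategoryTheory NumberField Cardinal IsDedekindDomain
open scoped NumberField nonZeroDivisors MonObj

namespace Literature.NumberTheory.ComplexMultiplication

open Literature.AlgebraicGeometry.Motives (CMType AbelianVariety AlgPoints specOver)
open Literature.AlgebraicGeometry.Motives.AbelianVariety
open Literature.AlgebraicGeometry.Motives.AlgPoints (specOverMapOfAlgHom)

namespace CMTypeUniformization

/-! ## §0 Bookkeeping -/

section Arith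

variable {K : Type} [Field K] [NumberField K]

/-- `𝔮 𝔟 = 𝔞` with `𝔞` invertible forces `𝔮 ≠ 0` (as a fractional ideal). [cite: Shimura1998, §7.4 Prop. 15, p. 58; §18.6 p. 128] -/
theorem coeIdeal_ne_zero_of_coeIdeal_mul_eq (𝔞 𝔟 : (FractionalIdeal (𝓞 K)⁰ K)ˣ) (𝔮 : Ideal (𝓞 K))
    (h𝔮𝔟 : (𝔮 : FractionalIdeal (𝓞 K)⁰ K) * (𝔟 : FractionalIdeal (𝓞 K)⁰ K) = 𝔞) :
    (𝔮 : FractionalIdeal (𝓞 K)⁰ K) ≠ 0 := by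
  intro h0
  apply Units.ne_zero 𝔞
  rw [← h𝔮𝔟, h0, zero_mul]

/-- `1 ∈ 𝔮 𝔮⁻¹` for `𝔮 ≠ 0`, as a membership in a product of `𝓞_K`-submodules of `K` (Dedekind: `𝔮 𝔮⁻¹ = 1`).
[cite: Shimura1998, §7.4 Prop. 15, p. 58] -/
theorem one_mem_coe_mul_coe_inv {𝔮 : Ideal (𝓞 K)} (h𝔮 : (𝔮 : FractionalIdeal (𝓞 K)⁰ K) ≠ 0) :
    (1 : K) ∈ ((𝔮 : FractionalIdeal (𝓞 K)⁰ K) : Submodule (𝓞 K) K) *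
      (((𝔮 : FractionalIdeal (𝓞 K)⁰ K)⁻¹ : FractionalIdeal (𝓞 K)⁰ K) : Submodule (𝓞 K) K) := by
  rw [← FractionalIdeal.coe_mul, mul_inv_cancel₀ h𝔮, FractionalIdeal.coe_one]
  exact Submodule.one_le.mp le_rfl

end Arith

/-! ## §1 `λ ∈ ⟨ι_A(𝔮) ≫ Hom_k(A, B)⟩` -/

section BaseChangeShape

variable {K : Type} [Field K] [NumberField K] {Φ : CMType K} {𝔞 𝔟 : (FractionalIdeal (𝓞 K)⁰ K)ˣ}
  {k : Type} [Field k] [Algebra k ℂ] {A B : AbelianVariety k}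
  {ιA : 𝓞 K →+* End A} {ιB : 𝓞 K →+* End B}
  (ξ : CMTypeUniformization Φ 𝔞 (A.baseChange ℂ) ((endBaseChange ℂ A).comp ιA))
  (ηB : CMTypeUniformization Φ 𝔟 (B.baseChange ℂ) ((endBaseChange ℂ B).comp ιB))

/-- **The `𝔮`-multiplication lies in `ι_A(𝔮) · Hom_k(A, B)`** (base-change shape; the μ-free form of [Shimura1998]
§13.1 p. 98 / §18.6 p. 129 «`μ ∘ λ = ι(α)`»).  Let `k ⊆ ℂ` be countable, `𝔮 ⊆ 𝓞_K` with `𝔮 𝔟 = 𝔞`, and let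
`λ : A ⟶ B` over `k` induce `S(1)` (`λ_ℂ(ξ.r u) = ηB.r u`).  Then `λ` lies in the additive subgroup of `Hom_k(A, B)`
generated by the composites `ιA(α) ≫ g` with `α ∈ 𝔮`, `g : A ⟶ B`: writing `1 = Σᵢ αᵢ γᵢ` (`αᵢ ∈ 𝔮`, `γᵢ ∈ 𝔮⁻¹`),
the `k`-rational multiplications `λ_{γᵢ}` ([Shimura1998] §7.4 Prop. 15; `exists_hom_baseChange_map_r_eq_of_qMultiplication`)
give `Σᵢ ιA(αᵢ) ≫ λ_{γᵢ}`, which induces `S(Σ αᵢγᵢ) = S(1)` as `λ` does, hence equals `λ`.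
[cite: Shimura1998, §7.4 Prop. 15 and proof of Prop. 17 (p. 58); §13.1 proof of Thm. 1 (p. 98); §18.6 proof of Thm. 18.6 (p. 129)] -/
theorem mem_closure_ι_comp_of_baseChange_map_r_eq (hk : #k ≤ ℵ₀) (𝔮 : Ideal (𝓞 K))
    (h𝔮𝔟 : (𝔮 : FractionalIdeal (𝓞 K)⁰ K) * (𝔟 : FractionalIdeal (𝓞 K)⁰ K) = 𝔞) {lam : A ⟶ B}
    (hlam : ∀ u : K, AlgPoints.map (Hom.baseChange ℂ lam).hom.hom.hom (ξ.r u) = ηB.r u) :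
    lam ∈ AddSubgroup.closure
      {h : A ⟶ B | ∃ a ∈ (fun α : 𝓞 K ↦ ιA α) '' (𝔮 : Set (𝓞 K)), ∃ g : A ⟶ B, h = (a : A ⟶ A) ≫ g} := by
  have hlam1 : ∀ u : K, AlgPoints.map (Hom.baseChange ℂ lam).hom.hom.hom (ξ.r u) = ηB.r (1 * u) :=
    fun u ↦ by rw [one_mul]; exact hlam u
  -- induction over `𝔮 𝔮⁻¹ ∋ 1`: every `x ∈ 𝔮 𝔮⁻¹` is induced, as `S(x)`, by a member of the subgroup
  have key : ∀ x : K, x ∈ ((𝔮 : FractionalIdeal (𝓞 K)⁰ K) : Submodule (𝓞 K) K) *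
      (((𝔮 : FractionalIdeal (𝓞 K)⁰ K)⁻¹ : FractionalIdeal (𝓞 K)⁰ K) : Submodule (𝓞 K) K) →
      ∃ h ∈ AddSubgroup.closure
          {h : A ⟶ B | ∃ a ∈ (fun α : 𝓞 K ↦ ιA α) '' (𝔮 : Set (𝓞 K)), ∃ g : A ⟶ B, h = (a : A ⟶ A) ≫ g},
        ∀ u : K, AlgPoints.map (Hom.baseChange ℂ h).hom.hom.hom (ξ.r u) = ηB.r (x * u) := by
    intro x hx
    refine Submodule.mul_induction_on hx (fun y hy z hz ↦ ?_) (fun x x' ⟨h, hh, hhr⟩ ⟨h', hh', hhr'⟩ ↦ ?_)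
    · -- generator `y z`, `y = α ∈ 𝔮`, `z = γ ∈ 𝔮⁻¹`: the member `ιA(α) ≫ λ_γ`
      rw [FractionalIdeal.mem_coe, FractionalIdeal.mem_coeIdeal] at hy
      obtain ⟨α, hα, rfl⟩ := hy
      rw [FractionalIdeal.mem_coe] at hz
      obtain ⟨m, -, hm⟩ := ξ.exists_hom_baseChange_map_r_eq_of_qMultiplication ηB hk 𝔮 h𝔮𝔟 hlam hz
      exact ⟨(ιA α : A ⟶ A) ≫ m, AddSubgroup.subset_closure ⟨ιA α, ⟨α, hα, rfl⟩, m, rfl⟩,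
        fun u ↦ ξ.ι_comp_baseChange_map_r_eq ηB hm α u⟩
    · -- sum
      exact ⟨h + h', add_mem hh hh', ξ.add_baseChange_map_r_eq ηB hhr hhr'⟩
  obtain ⟨h, hh, hhr⟩ := key 1 (one_mem_coe_mul_coe_inv (coeIdeal_ne_zero_of_coeIdeal_mul_eq 𝔞 𝔟 𝔮 h𝔮𝔟))
  rwa [ξ.hom_eq_of_forall_baseChange_map_r_eq (m := lam) (m' := h) fun u ↦ by rw [hlam1, hhr]]

end BaseChangeShape

section KShape

variable {K : Type} [Field K] [NumberField K] {Φ : CMType K} {𝔞 𝔟 : (FractionalIdeal (𝓞 K)⁰ K)ˣ}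
  {k : Type} [Field k] [Algebra k ℂ] {A B : AbelianVariety k}
  {ιA : 𝓞 K →+* End A} {ιB : 𝓞 K →+* End B}
  (ξ₀ : CMTypeUniformization Φ 𝔞 A ιA) (η₀ : CMTypeUniformization Φ 𝔟 B ιB)

/-- **The `𝔮`-multiplication lies in `ι_A(𝔮) · Hom_k(A, B)` — `k`-shape uniformisations** (the binders
`(ξ ηB lam _hlam)` of `shimuraTaniyamaPair_degOne'`, verbatim): pass to the base-change shape by
`exists_baseChange_map_baseChange_r_eq` and apply `mem_closure_ι_comp_of_baseChange_map_r_eq` (the subgroup does not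
depend on the uniformisations). [cite: Shimura1998, §7.4 Prop. 15 and proof of Prop. 17 (p. 58); §18.6 proof of Thm. 18.6 (p. 129)] -/
theorem mem_closure_ι_comp_of_map_r_eq (hk : #k ≤ ℵ₀) (𝔮 : Ideal (𝓞 K))
    (h𝔮𝔟 : (𝔮 : FractionalIdeal (𝓞 K)⁰ K) * (𝔟 : FractionalIdeal (𝓞 K)⁰ K) = 𝔞) {lam : A ⟶ B}
    (hlam : ∀ u : K, AlgPoints.map lam.hom.hom.hom (ξ₀.r u) = η₀.r u) :
    lam ∈ AddSubgroup.closure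
      {h : A ⟶ B | ∃ a ∈ (fun α : 𝓞 K ↦ ιA α) '' (𝔮 : Set (𝓞 K)), ∃ g : A ⟶ B, h = (a : A ⟶ A) ≫ g} := by
  obtain ⟨ξ, ηB, -, -, hlam'⟩ := exists_baseChange_map_baseChange_r_eq ξ₀ η₀ lam 1
    (fun u ↦ by rw [one_mul]; exact hlam u)
  exact ξ.mem_closure_ι_comp_of_baseChange_map_r_eq ηB hk 𝔮 h𝔮𝔟 fun u ↦ by rw [hlam', one_mul]

end KShape

/-! ## §2 Top of `stub_tangentKill`: `λ̃` kills every tangent vector killed by `ι̃_A(𝔮)` -/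

section Reduction

variable {K : Type} [Field K] [NumberField K] {Φ : CMType K} {𝔞 𝔟 : (FractionalIdeal (𝓞 K)⁰ K)ˣ}
  {k : Type} [Field k] [NumberField k] [Algebra k ℂ] {A B : AbelianVariety k}
  {ιA : 𝓞 K →+* End A} {ιB : 𝓞 K →+* End B} {v : HeightOneSpectrum (𝓞 k)}

/-- **The reduced `𝔮`-multiplication kills every point at the origin killed by the `ι̃_A(α)`, `α ∈ 𝔮`** — base-change
shape (the μ-free form of [Shimura1998] §13.1 proof of Thm. 1, p. 98, «hence `δλ̃ = 0`»).  Let `k ⊆ ℂ` be a number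
field, `ξ`, `ηB` uniformisations of the complexified structures of types `(K, Φ, 𝔞)`, `(K, Φ, 𝔟)`, `𝔮 𝔟 = 𝔞`,
`λ : A ⟶ B` inducing `S(1)`, `H : HomReduction R S` a reduction-of-homomorphisms datum at a place `v` ([Shimura1998]
§11.1 Prop. 12).  If every `R.redEnd (ιA α)`, `α ∈ 𝔮`, kills every `Rκ`-point of `Ā` at the origin (augmentation
`aug : Rκ → R₀` of `κ(v)`-algebras; the assembly takes `Rκ = κ(Ã)[ε]`), then so does `λ̃ = H.redHom λ`
(`λ ∈ ⟨ιA(𝔮) ≫ Hom(A, B)⟩`, §1, and the two-sided ideal `AbelianVarietyTangentKillers`).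
[cite: Shimura1998, §13.1 proof of Thm. 1 (p. 98); §18.6 proof of Thm. 18.6 (p. 129); §11.1 Prop. 12] -/
theorem forall_comp_redHom_eq_one_of_baseChange_map_r_eq
    (ξ : CMTypeUniformization Φ 𝔞 (A.baseChange ℂ) ((endBaseChange ℂ A).comp ιA))
    (ηB : CMTypeUniformization Φ 𝔟 (B.baseChange ℂ) ((endBaseChange ℂ B).comp ιB))
    (𝔮 : Ideal (𝓞 K)) (h𝔮𝔟 : (𝔮 : FractionalIdeal (𝓞 K)⁰ K) * (𝔟 : FractionalIdeal (𝓞 K)⁰ K) = 𝔞)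
    {lam : A ⟶ B} (hlam : ∀ u : K, AlgPoints.map (Hom.baseChange ℂ lam).hom.hom.hom (ξ.r u) = ηB.r u)
    {R : A.GoodReductionAt v} {S : B.GoodReductionAt v} (H : GoodReductionAt.HomReduction R S)
    {Rκ R₀ : Type} [CommRing Rκ] [Algebra v.asIdeal.ResidueField Rκ] [CommRing R₀]
    [Algebra v.asIdeal.ResidueField R₀] (aug : Rκ →ₐ[v.asIdeal.ResidueField] R₀)
    (hP1 : ∀ α ∈ 𝔮, ∀ t : specOver v.asIdeal.ResidueField Rκ ⟶ R.reduction.X,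
      specOverMapOfAlgHom aug ≫ t = 1 →
        t ≫ (R.redEnd (ιA α) : R.reduction ⟶ R.reduction).hom.hom.hom = 1)
    (t : specOver v.asIdeal.ResidueField Rκ ⟶ R.reduction.X) (ht : specOverMapOfAlgHom aug ≫ t = 1) :
    t ≫ (H.redHom lam).hom.hom.hom = 1 := by
  refine H.forall_comp_redHom_eq_one_of_mem_closure_comp
    (ξ.mem_closure_ι_comp_of_baseChange_map_r_eq ηB
      ((Algebra.IsAlgebraic.cardinalMk_le_max ℚ k).trans (by simp)) 𝔮 h𝔮𝔟 hlam)
    aug (fun a ha ↦ ?_) t ht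
  obtain ⟨α, hα, rfl⟩ := ha
  exact hP1 α hα

/-- **The reduced `𝔮`-multiplication kills every point at the origin killed by the `ι̃_A(α)`, `α ∈ 𝔮` — `k`-shape
uniformisations** (the binders `(ξ ηB lam _hlam R S H)` of `shimuraTaniyamaPair_degOne'`, verbatim; top of the E2
assembly's `stub_tangentKill`, which takes `Rκ := κ(Ã)[ε]`, `aug := fst` and feeds `hP1` from P1
«`δι̃(α) = 0` for `α ∈ 𝔮 = g(𝔭)`, `p ∤ d(K)`» through the cotangent ⇄ tangent-vector bridge).
[cite: Shimura1998, §13.1 proof of Thm. 1 (p. 98); §18.6 proof of Thm. 18.6 (p. 129); §11.1 Prop. 12] -/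
theorem forall_comp_redHom_eq_one_of_map_r_eq
    (ξ₀ : CMTypeUniformization Φ 𝔞 A ιA) (η₀ : CMTypeUniformization Φ 𝔟 B ιB)
    (𝔮 : Ideal (𝓞 K)) (h𝔮𝔟 : (𝔮 : FractionalIdeal (𝓞 K)⁰ K) * (𝔟 : FractionalIdeal (𝓞 K)⁰ K) = 𝔞)
    {lam : A ⟶ B} (hlam : ∀ u : K, AlgPoints.map lam.hom.hom.hom (ξ₀.r u) = η₀.r u)
    {R : A.GoodReductionAt v} {S : B.GoodReductionAt v} (H : GoodReductionAt.HomReduction R S)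
    {Rκ R₀ : Type} [CommRing Rκ] [Algebra v.asIdeal.ResidueField Rκ] [CommRing R₀]
    [Algebra v.asIdeal.ResidueField R₀] (aug : Rκ →ₐ[v.asIdeal.ResidueField] R₀)
    (hP1 : ∀ α ∈ 𝔮, ∀ t : specOver v.asIdeal.ResidueField Rκ ⟶ R.reduction.X,
      specOverMapOfAlgHom aug ≫ t = 1 →
        t ≫ (R.redEnd (ιA α) : R.reduction ⟶ R.reduction).hom.hom.hom = 1)
    (t : specOver v.asIdeal.ResidueField Rκ ⟶ R.reduction.X) (ht : specOverMapOfAlgHom aug ≫ t = 1) :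
    t ≫ (H.redHom lam).hom.hom.hom = 1 := by
  refine H.forall_comp_redHom_eq_one_of_mem_closure_comp
    (mem_closure_ι_comp_of_map_r_eq ξ₀ η₀
      ((Algebra.IsAlgebraic.cardinalMk_le_max ℚ k).trans (by simp)) 𝔮 h𝔮𝔟 hlam)
    aug (fun a ha ↦ ?_) t ht
  obtain ⟨α, hα, rfl⟩ := ha
  exact hP1 α hα

end Reduction

/-! ## §3 Cotangent form: `δι̃_A(α) = 0` for `α ∈ 𝔮` ⇒ `λ̃` kills the `L[ε]`-valued tangent vectors at the origin
(appended 2026-08-28, cell `hodgecm-mathlib`, E2 line: the composition with the cotangent ⇄ tangent-vector dictionary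
`AbelianVarietyTangentCotangentBridge`, so that `stub_tangentKill` closes by one name modulo P1) -/

section Cotangent

open TrivSqZeroExt

variable {K : Type} [Field K] [NumberField K] {Φ : CMType K} {𝔞 𝔟 : (FractionalIdeal (𝓞 K)⁰ K)ˣ}
  {k : Type} [Field k] [NumberField k] [Algebra k ℂ] {A B : AbelianVariety k}
  {ιA : 𝓞 K →+* End A} {ιB : 𝓞 K →+* End B} {v : HeightOneSpectrum (𝓞 k)}

/-- **`δι̃_A(α) = 0` for all `α ∈ 𝔮` ⇒ `δλ̃ = 0`, cotangent-hypothesis form** ([Shimura1998] §13.1 proof of Thm. 1,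
p. 98: «`δι̃(α) = 0` for every `α ∈ 𝔮` […] hence `δλ̃ = 0`», μ-free; §2.8: the differential of a homomorphism on
invariant forms = the tangent map at the origin, Görtz–Wedhorn II Rem. 27.18).  `k`-shape uniformisations (the binders
`(ξ η lam _hlam R S H)` of `shimuraTaniyamaPair_degOne'`): if every reduced endomorphism `R.redEnd (ιA α)`, `α ∈ 𝔮`,
induces ZERO on the cotangent space `𝔪_e/𝔪_e²` of `Ā` at the origin (`cotangentMap Ā (R.redEnd (ιA α)) = 0`, the P1
statement for `𝔮 = g(𝔭)`, `p ∤ d(K)`), then the reduced `𝔮`-multiplication `λ̃ = H.redHom λ` kills every `L[ε]`-point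
of `Ā` at the origin for every field `L ⊇ κ(v)` — the hypothesis of the LIE0′ factorisation through the relative
Frobenius (the assembly takes `L = κ(Ã)`).  Composition of `forall_comp_redHom_eq_one_of_map_r_eq` with the bridge
`forall_tangent_comp_eq_one_of_cotangentMap_end_eq_zero`.
[cite: Shimura1998, §13.1 proof of Thm. 1 (p. 98); §18.6 proof of Thm. 18.6 (p. 129); §2.8 Prop. 6] [cite: GortzWedhorn2023, Rem. 27.18 (1) and (4)] -/
theorem forall_tangent_comp_redHom_eq_one_of_forall_cotangentMap_eq_zero
    (ξ₀ : CMTypeUniformization Φ 𝔞 A ιA) (η₀ : CMTypeUniformization Φ 𝔟 B ιB)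
    (𝔮 : Ideal (𝓞 K)) (h𝔮𝔟 : (𝔮 : FractionalIdeal (𝓞 K)⁰ K) * (𝔟 : FractionalIdeal (𝓞 K)⁰ K) = 𝔞)
    {lam : A ⟶ B} (hlam : ∀ u : K, AlgPoints.map lam.hom.hom.hom (ξ₀.r u) = η₀.r u)
    {R : A.GoodReductionAt v} {S : B.GoodReductionAt v} (H : GoodReductionAt.HomReduction R S)
    (hP1 : ∀ α ∈ 𝔮, cotangentMap R.reduction (R.redEnd (ιA α) : R.reduction ⟶ R.reduction) = 0)
    (L : Type) [Field L] [Algebra v.asIdeal.ResidueField L]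
    (t : specOver v.asIdeal.ResidueField (DualNumber L) ⟶ R.reduction.X)
    (ht : specOverMapOfAlgHom (fstHom v.asIdeal.ResidueField L L) ≫ t = 1) :
    t ≫ (H.redHom lam).hom.hom.hom = 1 :=
  forall_comp_redHom_eq_one_of_map_r_eq ξ₀ η₀ 𝔮 h𝔮𝔟 hlam H (fstHom v.asIdeal.ResidueField L L)
    (fun α hα ↦ forall_tangent_comp_eq_one_of_cotangentMap_end_eq_zero L _ (hP1 α hα)) t ht

/-- **Cotangent-hypothesis form, base-change-shape uniformisations** (twin of
`forall_tangent_comp_redHom_eq_one_of_forall_cotangentMap_eq_zero` for the currency of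
`CMTypeUniformizationDescendedMultiplications`). [cite: Shimura1998, §13.1 proof of Thm. 1 (p. 98); §18.6 proof of Thm. 18.6 (p. 129)]
[cite: GortzWedhorn2023, Rem. 27.18 (1) and (4)] -/
theorem forall_tangent_comp_redHom_eq_one_of_forall_cotangentMap_eq_zero'
    (ξ : CMTypeUniformization Φ 𝔞 (A.baseChange ℂ) ((endBaseChange ℂ A).comp ιA))
    (ηB : CMTypeUniformization Φ 𝔟 (B.baseChange ℂ) ((endBaseChange ℂ B).comp ιB))
    (𝔮 : Ideal (𝓞 K)) (h𝔮𝔟 : (𝔮 : FractionalIdeal (𝓞 K)⁰ K) * (𝔟 : FractionalIdeal (𝓞 K)⁰ K) = 𝔞)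
    {lam : A ⟶ B} (hlam : ∀ u : K, AlgPoints.map (Hom.baseChange ℂ lam).hom.hom.hom (ξ.r u) = ηB.r u)
    {R : A.GoodReductionAt v} {S : B.GoodReductionAt v} (H : GoodReductionAt.HomReduction R S)
    (hP1 : ∀ α ∈ 𝔮, cotangentMap R.reduction (R.redEnd (ιA α) : R.reduction ⟶ R.reduction) = 0)
    (L : Type) [Field L] [Algebra v.asIdeal.ResidueField L]
    (t : specOver v.asIdeal.ResidueField (DualNumber L) ⟶ R.reduction.X)
    (ht : specOverMapOfAlgHom (fstHom v.asIdeal.ResidueField L L) ≫ t = 1) :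
    t ≫ (H.redHom lam).hom.hom.hom = 1 :=
  forall_comp_redHom_eq_one_of_baseChange_map_r_eq ξ ηB 𝔮 h𝔮𝔟 hlam H (fstHom v.asIdeal.ResidueField L L)
    (fun α hα ↦ forall_tangent_comp_eq_one_of_cotangentMap_end_eq_zero L _ (hP1 α hα)) t ht

end Cotangent

end CMTypeUniformization

end Literature.NumberTheory.ComplexMultiplication

end
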